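import Literature.Barriers.CriticalPhenomena.LongRangeTrivialityOnZ3MonotoneBlockingAudit
import Mathlib.Topology.Algebra.InfiniteSum.Real
import Mathlib.Topology.Order.MonotoneConvergence
import HarnessLib

/-!
# LATTICE BOOKKEEPING FOR NEWMAN'S BLOCK ARGUMENT ON `ℤ^d`: per-site covariance sums `|Λ_L|⁻¹ Σ_{x,y∈Λ_L} γ(y−x) → Σ_z γ(z)`,
# the block map `z ↦ ⌊(z + k)/(2k+1)⌋` and the volume fraction of the full blocks

Claimed R42 (8)(c) in the cell INBOX at 2026-08-28T13:11:28Z by fkp-10a gen 354 (NEW CLAIM #1 of the gen), under provision (ι) (no coordinator seated since gen 272's closing line l.8385: the lane lead absorbs the registry word, silence = consent; readers fk-ref / fkt-lead / fkp-18r / fkp-10b); lineage row FO-10a-g354 (self-suggested), package g354-newmanclt, label NC-C.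
Helper file of the `fk-continuity` build cell (bschramm lane; `--supports stmt-CriticalPhenomena-4575`); builds on
p205010 (kernel theorem, internal audit signed; external expert review pending). No definitions, no named facts, no
sorries; standard axioms. UNCONDITIONAL. Pure lattice combinatorics / real analysis on `Site d = ℤ^d` with the boxes
`box d L = [-L, L]^d` of `Literature/Probability/LatticeModels/ThermodynamicLimit.lean`; the overlap counts and the
difference-variable reindexing are the tree's `LongRangeIsing.sum_sum_box_eq_sum_mul_card` /
`LongRangeIsing.sum_sum_box_div_card_mono` (Barriers/…/LongRangeTrivialityOnZ3MonotoneBlockingAudit), the cofinality of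
boxes is the tree's `eventually_subset_box_holds` (LatticeModels/GKSInequalities).

* `sum_sum_box_div_card_le_tsum`, `tendsto_sum_sum_box_div_card` — for a nonnegative summable kernel `γ` on `ℤ^d`,
  `a(L) = |Λ_L|⁻¹ Σ_{x,y∈Λ_L} γ(y − x)` satisfies `a(L) ≤ Σ_z γ(z)` and `a(L) → Σ_z γ(z)` (Newman's hypothesis (D)
  "finite susceptibility" gives the variance density `σ² = Σ_z Cov(X_0, X_z)`).
* the BLOCK MAP `β_k z = (⌊(z_i + k)/(2k+1)⌋)_i` (pinned by its defining equation, no definition): every `z` lies in the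
  block `(2k+1)β_k(z) + Λ_k` (`sub_blockLabel_mem_box`), the block of `u` is labelled `u` (`blockLabel_block_eq`), full
  blocks `(2k+1)u + Λ_k`, `u ∈ Λ_m`, `(2k+1)m + k ≤ n`, lie in `Λ_n` and are exactly the fibres of `β_k` there
  (`filter_blockLabel_eq_image`), fibres have at most `|Λ_k|` sites, double kernel sums over a translated box equal those
  over `Λ_k` (`sum_sum_image_add_eq`), and the full blocks fill `Λ_n` asymptotically:
  `|Λ_{(n−k)/(2k+1)}| · |Λ_k| / |Λ_n| → 1` (`tendsto_card_box_mul_card_box_div`).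

## References

* C. M. Newman, *Normal fluctuations and the FKG inequalities*, Comm. Math. Phys. 74 (1980) 119–128, Thm. 2 (D) and
  its proof (block variables (1)–(3)). [Newman1980]
* S. Friedli, Y. Velenik, *Statistical Mechanics of Lattice Systems*, CUP 2017, §3.2 (boxes `B(n)`). [FriedliVelenikSMLS2017]
* G. Grimmett, *The Random-Cluster Model*, Springer 2006, §4.3 (translation-invariant box limits). [Grimmett2006]
-/

noncomputable section

namespace Summit.CriticalPhenomena.PercolationContinuityZ3.Theorems.FK

namespace NewmanCLT

open Finset Filter Topology
open Literature.Probability.LatticeModels Literature.Barriers.CriticalPhenomena.LongRangeIsing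

variable {d : ℕ}

/-! ### Per-site double sums of a nonnegative summable kernel -/

/-- `(box d L).card > 0` as a real number. [folklore] -/
theorem card_box_pos (d L : ℕ) : (0 : ℝ) < #(box d L) := by exact_mod_cast (box_nonempty d L).card_pos

/-- **Upper bound**: for `γ ≥ 0` summable, `|Λ_L|⁻¹ Σ_{x,y∈Λ_L} γ(y − x) ≤ Σ_z γ(z)` (each overlap count is at most `|Λ_L|`).
[cite: Newman1980, Thm. 2 (D)] -/
theorem sum_sum_box_div_card_le_tsum (γ : Site d → ℝ) (hγ0 : ∀ z, 0 ≤ γ z) (hγ : Summable γ) (L : ℕ) :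
    (∑ x ∈ box d L, ∑ y ∈ box d L, γ (y - x)) / #(box d L) ≤ ∑' z, γ z := by
  rw [div_le_iff₀ (card_box_pos d L), sum_sum_box_eq_sum_mul_card γ (le_refl (2 * L))]
  calc ∑ z ∈ box d (2 * L), γ z * #((box d L).filter fun x => x + z ∈ box d L)
      ≤ ∑ z ∈ box d (2 * L), γ z * #(box d L) := Finset.sum_le_sum fun z _ =>
        mul_le_mul_of_nonneg_left (by exact_mod_cast card_filter_le _ _) (hγ0 z)
    _ = (∑ z ∈ box d (2 * L), γ z) * #(box d L) := by rw [Finset.sum_mul]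
    _ ≤ (∑' z, γ z) * #(box d L) :=
        mul_le_mul_of_nonneg_right (hγ.sum_le_tsum _ fun z _ => hγ0 z) (Nat.cast_nonneg _)

/-- The overlap fraction of a fixed translate tends to one: `#{x ∈ Λ_L : x + z ∈ Λ_L} / |Λ_L| → 1` as `L → ∞`
(it is squeezed between `(|Λ_{L−s}|/|Λ_L|)` for `z ∈ Λ_s` and `1`). [folklore] -/
theorem tendsto_card_filter_add_mem_div (z : Site d) :
    Tendsto (fun L : ℕ => (#((box d L).filter fun x => x + z ∈ box d L) : ℝ) / #(box d L)) atTop (𝓝 1) := by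
  obtain ⟨s, hs'⟩ := (eventually_subset_box_holds (d := d) {z}).exists
  have hs : z ∈ box d s := hs' (mem_singleton_self z)
  -- lower bound `((2(L-s)+1)/(2L+1))^d` for `L ≥ s`
  have hlow : ∀ L : ℕ, s ≤ L → ((2 * ((L : ℝ) - s) + 1) / (2 * L + 1)) ^ d ≤
      (#((box d L).filter fun x => x + z ∈ box d L) : ℝ) / #(box d L) := by
    intro L hL
    have hsub : box d (L - s) ⊆ (box d L).filter fun x => x + z ∈ box d L := by
      intro x hx
      rw [mem_filter, mem_box, mem_box]
      rw [mem_box] at hx hs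
      refine ⟨fun i => ?_, fun i => ?_⟩
      · have := hx i; constructor <;> omega
      · have h1 := hx i; have h2 := hs i
        simp only [Pi.add_apply]
        constructor <;> omega
    have hcard : ((2 * ((L : ℝ) - s) + 1)) ^ d = #(box d (L - s)) := by
      rw [card_box]; push_cast [Nat.cast_sub hL]; ring
    have hcardL : ((2 * (L : ℝ) + 1)) ^ d = #(box d L) := by rw [card_box]; push_cast; ring
    rw [div_pow, hcard, hcardL]
    exact div_le_div_of_nonneg_right (by exact_mod_cast card_le_card hsub) (Nat.cast_nonneg _)
  have hup : ∀ L : ℕ, (#((box d L).filter fun x => x + z ∈ box d L) : ℝ) / #(box d L) ≤ 1 := fun L =>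
    (div_le_one (card_box_pos d L)).2 (by exact_mod_cast card_filter_le _ _)
  -- the lower bound tends to one
  have hlim : Tendsto (fun L : ℕ => ((2 * ((L : ℝ) - s) + 1) / (2 * L + 1)) ^ d) atTop (𝓝 1) := by
    have h1 : Tendsto (fun L : ℕ => (2 * ((L : ℝ) - s) + 1) / (2 * L + 1)) atTop (𝓝 1) := by
      have e : ∀ L : ℕ, (2 * ((L : ℝ) - s) + 1) / (2 * L + 1) = 1 - 2 * s / (2 * L + 1) := by
        intro L; field_simp; ring
      simp_rw [e]
      have h2 : Tendsto (fun L : ℕ => 2 * (s : ℝ) / (2 * L + 1)) atTop (𝓝 0) := by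
        refine tendsto_const_nhds.div_atTop ?_
        exact tendsto_atTop_add_const_right _ _
          (Tendsto.const_mul_atTop (by norm_num) tendsto_natCast_atTop_atTop)
      simpa using (tendsto_const_nhds (x := (1 : ℝ))).sub h2
    simpa using h1.pow d
  refine tendsto_of_tendsto_of_tendsto_of_le_of_le' hlim tendsto_const_nhds ?_ (Eventually.of_forall hup)
  exact (eventually_ge_atTop s).mono hlow

/-- **Per-site covariance sums converge to the susceptibility**: for `γ ≥ 0` summable on `ℤ^d`,
`|Λ_L|⁻¹ Σ_{x,y∈Λ_L} γ(y − x) → Σ_z γ(z)` as `L → ∞` (the variance density of a translation-covariant field with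
summable covariances). [cite: Newman1980, Thm. 2 (D) and (6)] -/
theorem tendsto_sum_sum_box_div_card (γ : Site d → ℝ) (hγ0 : ∀ z, 0 ≤ γ z) (hγ : Summable γ) :
    Tendsto (fun L : ℕ => (∑ x ∈ box d L, ∑ y ∈ box d L, γ (y - x)) / #(box d L)) atTop (𝓝 (∑' z, γ z)) := by
  rw [tendsto_order]
  refine ⟨fun b hb => ?_, fun b hb => Eventually.of_forall fun L => (sum_sum_box_div_card_le_tsum γ hγ0 hγ L).trans_lt hb⟩
  -- partial sums over boxes exceed `b` eventually
  have hpart : Tendsto (fun R : ℕ => ∑ z ∈ box d R, γ z) atTop (𝓝 (∑' z, γ z)) :=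
    hγ.hasSum.comp (Filter.tendsto_atTop.2 (eventually_subset_box_holds (d := d)))
  obtain ⟨R, hR⟩ := ((tendsto_order.1 hpart).1 b hb).exists
  -- the truncated sums with overlap fractions converge to the partial sum over `Λ_R`
  have htrunc : Tendsto (fun L : ℕ => ∑ z ∈ box d R,
      γ z * ((#((box d L).filter fun x => x + z ∈ box d L) : ℝ) / #(box d L))) atTop (𝓝 (∑ z ∈ box d R, γ z)) := by
    have := tendsto_finsetSum (box d R) fun z _ => (tendsto_card_filter_add_mem_div (d := d) z).const_mul (γ z)
    simpa using this
  have hev := (tendsto_order.1 htrunc).1 b hR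
  filter_upwards [hev, eventually_ge_atTop R] with L hL hLR
  refine hL.trans_le ?_
  rw [le_div_iff₀ (card_box_pos d L), sum_sum_box_eq_sum_mul_card γ (le_refl (2 * L)), Finset.sum_mul]
  calc ∑ z ∈ box d R, γ z * ((#((box d L).filter fun x => x + z ∈ box d L) : ℝ) / #(box d L)) * #(box d L)
      = ∑ z ∈ box d R, γ z * #((box d L).filter fun x => x + z ∈ box d L) :=
        Finset.sum_congr rfl fun z _ => by rw [mul_assoc, div_mul_cancel₀ _ (card_box_pos d L).ne']
    _ ≤ ∑ z ∈ box d (2 * L), γ z * #((box d L).filter fun x => x + z ∈ box d L) :=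
        Finset.sum_le_sum_of_subset_of_nonneg (box_mono d (by omega)) fun z _ _ =>
          mul_nonneg (hγ0 z) (Nat.cast_nonneg _)

/-! ### The block map `β_k z = ⌊(z + k)/(2k+1)⌋` (coordinatewise), pinned by its defining equation -/

section Blocks

variable {k m n : ℕ} {β : Site d → Site d}

/-- Every site lies in its own block: `z − (2k+1) β_k(z) ∈ Λ_k`. [cite: Newman1980, (1)–(3)] -/
theorem sub_blockLabel_mem_box (hβ : ∀ z i, β z i = (z i + k) / (2 * k + 1)) (z : Site d) :
    (fun i => z i - (2 * k + 1) * β z i) ∈ box d k := by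
  rw [mem_box]
  intro i
  rw [hβ z i]
  have hb : (0 : ℤ) < 2 * k + 1 := by positivity
  have h1 := Int.emod_def (z i + k) (2 * k + 1)
  have h2 := Int.emod_nonneg (z i + k) hb.ne'
  have h3 := Int.emod_lt_of_pos (z i + k) hb
  constructor <;> linarith

/-- The block of `u` is labelled `u`: `β_k((2k+1)u + w) = u` for `w ∈ Λ_k`. [cite: Newman1980, (1)–(3)] -/
theorem blockLabel_block_eq (hβ : ∀ z i, β z i = (z i + k) / (2 * k + 1)) (u : Site d) {w : Site d}
    (hw : w ∈ box d k) : β (fun i => (2 * k + 1) * u i + w i) = u := by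
  funext i
  rw [hβ]
  rw [mem_box] at hw
  have hb : (0 : ℤ) < 2 * k + 1 := by positivity
  have hwi := hw i
  have e : (2 * (k : ℤ) + 1) * u i + w i + k = (w i + k) + u i * (2 * k + 1) := by ring
  rw [e, Int.add_mul_ediv_right _ _ hb.ne', Int.ediv_eq_zero_of_lt (by omega) (by omega), zero_add]

/-- Full blocks lie in the big box: `(2k+1)u + w ∈ Λ_n` for `u ∈ Λ_m`, `w ∈ Λ_k`, `(2k+1)m + k ≤ n`.
[cite: Newman1980, (1)–(3)] -/
theorem block_mem_box (hkm : (2 * k + 1) * m + k ≤ n) {u w : Site d} (hu : u ∈ box d m) (hw : w ∈ box d k) :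
    (fun i => (2 * k + 1) * u i + w i) ∈ box d n := by
  rw [mem_box] at hu hw ⊢
  intro i
  have h1 := hu i
  have h2 := hw i
  have hkm' : (2 * (k : ℤ) + 1) * m + k ≤ n := by exact_mod_cast hkm
  constructor <;> nlinarith

/-- **Fibres of full blocks**: for `u ∈ Λ_m`, `(2k+1)m + k ≤ n`, the sites of `Λ_n` labelled `u` are exactly the block
`(2k+1)u + Λ_k`. [cite: Newman1980, (1)–(3)] -/
theorem filter_blockLabel_eq_image [DecidableEq (Site d)] (hβ : ∀ z i, β z i = (z i + k) / (2 * k + 1))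
    (hkm : (2 * k + 1) * m + k ≤ n) {u : Site d} (hu : u ∈ box d m) :
    (box d n).filter (fun z => β z = u) = (box d k).image fun w i => (2 * k + 1) * u i + w i := by
  ext z
  simp only [mem_filter, mem_image]
  constructor
  · rintro ⟨-, hzu⟩
    refine ⟨fun i => z i - (2 * k + 1) * β z i, sub_blockLabel_mem_box hβ z, ?_⟩
    funext i
    rw [hzu]
    ring
  · rintro ⟨w, hw, rfl⟩
    exact ⟨block_mem_box hkm hu hw, blockLabel_block_eq hβ u hw⟩

/-- A fibre of the block map has at most `|Λ_k|` sites (it lies in one block). [cite: Newman1980, (1)–(3)] -/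
theorem card_filter_blockLabel_le [DecidableEq (Site d)] (hβ : ∀ z i, β z i = (z i + k) / (2 * k + 1))
    (A : Finset (Site d)) (u : Site d) : #(A.filter fun z => β z = u) ≤ #(box d k) := by
  refine Finset.card_le_card_of_injOn (fun z i => z i - (2 * k + 1) * u i) (fun z hz => ?_) fun z hz z' hz' h => ?_
  · rw [mem_coe, mem_filter] at hz
    have := sub_blockLabel_mem_box hβ z
    rw [hz.2] at this
    exact this
  · funext i
    have := congr_fun h i
    simpa using this

/-- The full-block labels are attained: `Λ_m ⊆ β_k(Λ_n)` when `(2k+1)m + k ≤ n`. [cite: Newman1980, (1)–(3)] -/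
theorem box_subset_image_blockLabel [DecidableEq (Site d)] (hβ : ∀ z i, β z i = (z i + k) / (2 * k + 1))
    (hkm : (2 * k + 1) * m + k ≤ n) : box d m ⊆ (box d n).image β := by
  intro u hu
  rw [mem_image]
  refine ⟨fun i => (2 * k + 1) * u i + (0 : Site d) i, block_mem_box hkm hu (zero_mem_box d k), ?_⟩
  exact blockLabel_block_eq hβ u (zero_mem_box d k)

end Blocks

/-- **Translation invariance of double kernel sums**: `Σ_{x,y ∈ v + Λ_k} γ(y − x) = Σ_{x,y∈Λ_k} γ(y − x)`. [folklore] -/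
theorem sum_sum_image_add_eq [DecidableEq (Site d)] (γ : Site d → ℝ) (v : Site d) (k : ℕ) :
    ∑ x ∈ (box d k).image (fun w i => v i + w i), ∑ y ∈ (box d k).image (fun w i => v i + w i), γ (y - x) =
      ∑ x ∈ box d k, ∑ y ∈ box d k, γ (y - x) := by
  have hinj : Set.InjOn (fun (w : Site d) i => v i + w i) ↑(box d k) := fun w _ w' _ h => by
    funext i; have := congr_fun h i; simpa using this
  rw [Finset.sum_image hinj]
  refine Finset.sum_congr rfl fun x _ => ?_
  rw [Finset.sum_image hinj]
  refine Finset.sum_congr rfl fun y _ => ?_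
  congr 1
  funext i
  simp only [Pi.sub_apply]
  ring

/-! ### The full blocks fill the box -/

/-- With `m = ⌊(n − k)/(2k+1)⌋`: `(2k+1)m + k ≤ n` for `k ≤ n`. [folklore] -/
theorem blockCount_spec {k n : ℕ} (hkn : k ≤ n) : (2 * k + 1) * ((n - k) / (2 * k + 1)) + k ≤ n := by
  have := Nat.div_mul_le_self (n - k) (2 * k + 1)
  rw [mul_comm] at this
  omega

/-- **The full blocks fill `Λ_n` asymptotically**: `|Λ_m| · |Λ_k| / |Λ_n| → 1` for `m = ⌊(n − k)/(2k+1)⌋`, `k` fixed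
(`(2m+1)(2k+1) ∈ [2n − 4k + 1, 2n + 1]`). [cite: Newman1980, proof of Thm. 2] -/
theorem tendsto_card_box_mul_card_box_div (d k : ℕ) :
    Tendsto (fun n : ℕ => (#(box d ((n - k) / (2 * k + 1))) : ℝ) * #(box d k) / #(box d n)) atTop (𝓝 1) := by
  -- squeeze between `((2n - 4k + 1)/(2n+1))^d` (for `n ≥ 2k`) and `1`
  have hform : ∀ n : ℕ, (#(box d ((n - k) / (2 * k + 1))) : ℝ) * #(box d k) / #(box d n) =
      (((2 * ((n - k) / (2 * k + 1) : ℕ) + 1 : ℕ) * (2 * k + 1 : ℕ) : ℝ) / (2 * n + 1 : ℕ)) ^ d := by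
    intro n
    rw [card_box, card_box, card_box, div_pow, mul_pow]
    push_cast
    ring
  simp_rw [hform]
  have hup : ∀ n : ℕ, k ≤ n →
      (((2 * ((n - k) / (2 * k + 1) : ℕ) + 1 : ℕ) * (2 * k + 1 : ℕ) : ℝ) / (2 * n + 1 : ℕ)) ^ d ≤ 1 := by
    intro n hn
    refine pow_le_one₀ (by positivity) ((div_le_one (by positivity)).2 ?_)
    have h := blockCount_spec hn
    have h' : (2 * ((n - k) / (2 * k + 1)) + 1) * (2 * k + 1) ≤ 2 * n + 1 := by nlinarith
    exact_mod_cast h'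
  have hlow : ∀ n : ℕ, 2 * k ≤ n →
      (((2 * (n : ℝ) - 4 * k + 1)) / (2 * n + 1 : ℕ)) ^ d ≤
        (((2 * ((n - k) / (2 * k + 1) : ℕ) + 1 : ℕ) * (2 * k + 1 : ℕ) : ℝ) / (2 * n + 1 : ℕ)) ^ d := by
    intro n hn
    set q : ℕ := (n - k) / (2 * k + 1) with hq
    have hmod : (n - k) % (2 * k + 1) < 2 * k + 1 := Nat.mod_lt (n - k) (by omega)
    have hdiv : (2 * k + 1) * q + (n - k) % (2 * k + 1) = n - k := Nat.div_add_mod (n - k) (2 * k + 1)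
    have hkn : k ≤ n := by omega
    have h' : 2 * n + 1 ≤ (2 * q + 1) * (2 * k + 1) + 4 * k := by
      zify [hkn] at hdiv hmod ⊢
      nlinarith [hdiv, hmod]
    have h2k : (2 * k : ℝ) ≤ n := by exact_mod_cast hn
    refine pow_le_pow_left₀ (div_nonneg (by linarith) (Nat.cast_nonneg _))
      (div_le_div_of_nonneg_right ?_ (Nat.cast_nonneg _)) d
    have h'' : (2 * (n : ℝ) + 1) ≤ ((2 * q + 1) * (2 * k + 1) : ℕ) + 4 * k := by exact_mod_cast h'
    push_cast at h'' ⊢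
    linarith
  have hlim : Tendsto (fun n : ℕ => (((2 * (n : ℝ) - 4 * k + 1)) / (2 * n + 1 : ℕ)) ^ d) atTop (𝓝 1) := by
    have h1 : Tendsto (fun n : ℕ => ((2 * (n : ℝ) - 4 * k + 1)) / (2 * n + 1 : ℕ)) atTop (𝓝 1) := by
      have e : ∀ n : ℕ, ((2 * (n : ℝ) - 4 * k + 1)) / (2 * n + 1 : ℕ) = 1 - 4 * k / (2 * n + 1) := by
        intro n; push_cast; field_simp; ring
      simp_rw [e]
      have h2 : Tendsto (fun n : ℕ => 4 * (k : ℝ) / (2 * n + 1)) atTop (𝓝 0) := by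
        refine tendsto_const_nhds.div_atTop ?_
        exact tendsto_atTop_add_const_right _ _
          (Tendsto.const_mul_atTop (by norm_num) tendsto_natCast_atTop_atTop)
      simpa using (tendsto_const_nhds (x := (1 : ℝ))).sub h2
    simpa using h1.pow d
  refine tendsto_of_tendsto_of_tendsto_of_le_of_le' hlim tendsto_const_nhds ?_ ?_
  · exact (eventually_ge_atTop (2 * k)).mono hlow
  · exact (eventually_ge_atTop k).mono hup

end NewmanCLT

end Summit.CriticalPhenomena.PercolationContinuityZ3.Theorems.FK
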